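import Summits.HodgeConjecture.HodgeCM.Model.PadH6_1

/-! PORT of `HodgeCM/Model/PadH6.lean` (HodgeCMPerL run 82) — part 2: continuation of `Summits.HodgeConjecture.HodgeCM.Model.PadH6_1` (split at a top-level declaration boundary by port_pkg.py; scope re-opened below; declarations unchanged). -/

-- port_pkg: scope re-opened for this part (file-level context, then the namespace/section stack open at the cut)
noncomputable section
open scoped TensorProduct
namespace HodgeCM
open Literature.AlgebraicGeometry.Motives (CMType HodgeStructure)
open Literature.AlgebraicGeometry.Motives.HodgeStructure (EndAction ofRat complexConj prodEquiv pureFiltration)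
namespace Universe
variable (U : Universe)
/-- **The padded universe `U♯`**: same varieties, morphisms, products, CM data and Picard modular surfaces; same
cohomology in every degree `≠ 6` (definitionally in the literal degrees); `H♯⁶(X) = H⁶(X) ⊕ H⁶(X)` with diagonal
pull-backs, the pad purely of type `(3,3)`, no new algebraic classes, cup products and traces through the first summand. -/
@[reducible] def padH6 : Universe :=
  { U with
    Coh := fun X k => PadSix.Pad k (U.Coh X k) (U.Coh X 6)
    instAddCommGroup := fun X k => PadSix.instAddCommGroup (U.Coh X k) (U.Coh X 6) k
    instModule := fun X k => PadSix.instModule (U.Coh X k) (U.Coh X 6) k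
    instFinite := fun X k => PadSix.instFinite (U.Coh X k) (U.Coh X 6) k
    hodge := fun X k => PadSix.hodge (U.Coh X k) (U.Coh X 6) k (U.hodge X k) (U.padHodge X)
    alg := fun X p => PadSix.sub (U.Coh X (2 * p)) (U.Coh X 6) (2 * p) (U.alg X p)
    pull := fun f k => PadSix.map k (U.pull f k) (U.pull f 6)
    cup := fun X i j =>
      LinearMap.compr₂ ((U.cup X i j).compl₁₂ (PadSix.fst (U.Coh X i) (U.Coh X 6) i) (PadSix.fst (U.Coh X j) (U.Coh X 6) j))
        (PadSix.inl (U.Coh X (i + j)) (U.Coh X 6) (i + j))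
    tr := fun X k => U.tr X k ∘ₗ PadSix.fst (U.Coh X k) (U.Coh X 6) k
    cmAct := fun K Φ => U.cmAct K Φ }

/-! ## 2. API: the two summands -/

namespace PadH6

variable {U}

/-- the geometric summand `H♯^k(X) → H^k(X)` (the identity off degree `6`) -/
def toU (X : U.Var) (k : ℕ) : U.padH6.Coh X k →ₗ[ℚ] U.Coh X k := PadSix.fst (U.Coh X k) (U.Coh X 6) k

/-- the pad component `H♯^k(X) → H⁶(X)` (zero off degree `6`) -/
def padOf (X : U.Var) (k : ℕ) : U.padH6.Coh X k →ₗ[ℚ] U.Coh X 6 := PadSix.snd (U.Coh X k) (U.Coh X 6) k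

/-- the inclusion of the geometric summand (the identity off degree `6`) -/
def ofU (X : U.Var) (k : ℕ) : U.Coh X k →ₗ[ℚ] U.padH6.Coh X k := PadSix.inl (U.Coh X k) (U.Coh X 6) k

/-- the inclusion of the pad (zero off degree `6`) -/
def ofPad (X : U.Var) (k : ℕ) : U.Coh X 6 →ₗ[ℚ] U.padH6.Coh X k := PadSix.inr (U.Coh X k) (U.Coh X 6) k

/-- (Ported verbatim from the HodgeCMPerL package; no docstring in the source.) -/
@[simp] theorem toU_ofU (X : U.Var) (k : ℕ) (x : U.Coh X k) : toU X k (ofU X k x) = x := PadSix.fst_inl k x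

/-- (Ported verbatim from the HodgeCMPerL package; no docstring in the source.) -/
@[simp] theorem padOf_ofU (X : U.Var) (k : ℕ) (x : U.Coh X k) : padOf X k (ofU X k x) = 0 := PadSix.snd_inl k x

/-- (Ported verbatim from the HodgeCMPerL package; no docstring in the source.) -/
@[simp] theorem toU_ofPad (X : U.Var) (k : ℕ) (v : U.Coh X 6) : toU X k (ofPad X k v) = 0 := PadSix.fst_inr k v

/-- (Ported verbatim from the HodgeCMPerL package; no docstring in the source.) -/
theorem ofU_toU_add (X : U.Var) (k : ℕ) (x : U.padH6.Coh X k) : ofU X k (toU X k x) + ofPad X k (padOf X k x) = x :=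
  PadSix.inl_fst_add_inr_snd k x

/-- (Ported verbatim from the HodgeCMPerL package; no docstring in the source.) -/
theorem ext_iff (X : U.Var) (k : ℕ) (x y : U.padH6.Coh X k) :
    x = y ↔ toU X k x = toU X k y ∧ padOf X k x = padOf X k y :=
  PadSix.ext_iff' k x y

/-- (Ported verbatim from the HodgeCMPerL package; no docstring in the source.) -/
theorem ofU_toU_of_ne (X : U.Var) {k : ℕ} (hk : k ≠ 6) (x : U.padH6.Coh X k) : ofU X k (toU X k x) = x :=
  PadSix.inl_fst_of_ne hk x

/-- (Ported verbatim from the HodgeCMPerL package; no docstring in the source.) -/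
theorem padOf_of_ne (X : U.Var) {k : ℕ} (hk : k ≠ 6) (x : U.padH6.Coh X k) : padOf X k x = 0 := PadSix.snd_of_ne hk x

/-- (Ported verbatim from the HodgeCMPerL package; no docstring in the source.) -/
theorem toU_bijective_of_ne (X : U.Var) {k : ℕ} (hk : k ≠ 6) : Function.Bijective (toU X k) :=
  PadSix.fst_bijective_of_ne hk

/-- (Ported verbatim from the HodgeCMPerL package; no docstring in the source.) -/
theorem ofU_injective (X : U.Var) (k : ℕ) : Function.Injective (ofU X k) := PadSix.inl_injective k

/-- degree six, concretely: `H♯⁶(X) = H⁶(X) × H⁶(X)` and the four maps are the product maps -/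
theorem toU_six (X : U.Var) (x : U.padH6.Coh X 6) : toU X 6 x = x.1 := rfl

/-- (Ported verbatim from the HodgeCMPerL package; no docstring in the source.) -/
theorem padOf_six (X : U.Var) (x : U.padH6.Coh X 6) : padOf X 6 x = x.2 := rfl

/-- (Ported verbatim from the HodgeCMPerL package; no docstring in the source.) -/
theorem ofU_six (X : U.Var) (x : U.Coh X 6) : ofU X 6 x = (x, 0) := rfl

/-- (Ported verbatim from the HodgeCMPerL package; no docstring in the source.) -/
theorem ofPad_six (X : U.Var) (v : U.Coh X 6) : ofPad X 6 v = (0, v) := rfl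

/-! ### pull-backs, cup products, traces, algebraic classes, degree casts -/

/-- (Ported verbatim from the HodgeCMPerL package; no docstring in the source.) -/
theorem toU_pull {X Y : U.Var} (f : U.Mor X Y) (k : ℕ) (y : U.padH6.Coh Y k) :
    toU X k (U.padH6.pull f k y) = U.pull f k (toU Y k y) :=
  PadSix.fst_map k _ _ y

/-- (Ported verbatim from the HodgeCMPerL package; no docstring in the source.) -/
theorem padOf_pull {X Y : U.Var} (f : U.Mor X Y) (k : ℕ) (y : U.padH6.Coh Y k) :
    padOf X k (U.padH6.pull f k y) = U.pull f 6 (padOf Y k y) :=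
  PadSix.snd_map k _ _ y

/-- (Ported verbatim from the HodgeCMPerL package; no docstring in the source.) -/
theorem pull_ofU {X Y : U.Var} (f : U.Mor X Y) (k : ℕ) (y : U.Coh Y k) :
    U.padH6.pull f k (ofU Y k y) = ofU X k (U.pull f k y) :=
  PadSix.map_inl k _ _ y

/-- (Ported verbatim from the HodgeCMPerL package; no docstring in the source.) -/
theorem toU_comp_pull {X Y : U.Var} (f : U.Mor X Y) (k : ℕ) : toU X k ∘ₗ U.padH6.pull f k = U.pull f k ∘ₗ toU Y k :=
  LinearMap.ext (toU_pull f k)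

/-- (Ported verbatim from the HodgeCMPerL package; no docstring in the source.) -/
theorem padOf_comp_pull {X Y : U.Var} (f : U.Mor X Y) (k : ℕ) :
    padOf X k ∘ₗ U.padH6.pull f k = U.pull f 6 ∘ₗ padOf Y k :=
  LinearMap.ext (padOf_pull f k)

/-- (Ported verbatim from the HodgeCMPerL package; no docstring in the source.) -/
theorem cup_def (X : U.Var) (i j : ℕ) (x : U.padH6.Coh X i) (y : U.padH6.Coh X j) :
    U.padH6.cup X i j x y = ofU X (i + j) (U.cup X i j (toU X i x) (toU X j y)) := rfl

/-- (Ported verbatim from the HodgeCMPerL package; no docstring in the source.) -/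
theorem toU_cup (X : U.Var) (i j : ℕ) (x : U.padH6.Coh X i) (y : U.padH6.Coh X j) :
    toU X (i + j) (U.padH6.cup X i j x y) = U.cup X i j (toU X i x) (toU X j y) :=
  PadSix.fst_inl (i + j) _

/-- (Ported verbatim from the HodgeCMPerL package; no docstring in the source.) -/
theorem padOf_cup (X : U.Var) (i j : ℕ) (x : U.padH6.Coh X i) (y : U.padH6.Coh X j) :
    padOf X (i + j) (U.padH6.cup X i j x y) = 0 :=
  PadSix.snd_inl (i + j) _

/-- (Ported verbatim from the HodgeCMPerL package; no docstring in the source.) -/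
theorem tr_apply (X : U.Var) (k : ℕ) (x : U.padH6.Coh X k) : U.padH6.tr X k x = U.tr X k (toU X k x) := rfl

/-- (Ported verbatim from the HodgeCMPerL package; no docstring in the source.) -/
theorem mem_alg_iff (X : U.Var) (p : ℕ) (x : U.padH6.Coh X (2 * p)) :
    x ∈ U.padH6.alg X p ↔ toU X (2 * p) x ∈ U.alg X p ∧ padOf X (2 * p) x = 0 :=
  PadSix.mem_sub_iff (2 * p) _ x

/-- (Ported verbatim from the HodgeCMPerL package; no docstring in the source.) -/
theorem ofU_mem_alg (X : U.Var) (p : ℕ) {x : U.Coh X (2 * p)} (hx : x ∈ U.alg X p) : ofU X (2 * p) x ∈ U.padH6.alg X p :=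
  (mem_alg_iff X p _).mpr ⟨(toU_ofU X _ x).symm ▸ hx, padOf_ofU X _ x⟩

/-- (Ported verbatim from the HodgeCMPerL package; no docstring in the source.) -/
theorem toU_castCoh (X : U.Var) {k l : ℕ} (h : k = l) (x : U.padH6.Coh X k) :
    toU X l (U.padH6.castCoh X h x) = U.castCoh X h (toU X k x) := by
  subst h; rfl

/-- (Ported verbatim from the HodgeCMPerL package; no docstring in the source.) -/
theorem padOf_castCoh (X : U.Var) {k l : ℕ} (h : k = l) (x : U.padH6.Coh X k) :
    padOf X l (U.padH6.castCoh X h x) = padOf X k x := by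
  subst h; rfl

/-! ### complexification -/

/-- the geometric summand of `H♯^k(X, ℂ)` -/
def toUC (X : U.Var) (k : ℕ) : U.padH6.CohC X k →ₗ[ℂ] U.CohC X k := (toU X k).baseChange ℂ

/-- the pad component of `H♯^k(X, ℂ)` -/
def padOfC (X : U.Var) (k : ℕ) : U.padH6.CohC X k →ₗ[ℂ] U.CohC X 6 := (padOf X k).baseChange ℂ

/-- (Ported verbatim from the HodgeCMPerL package; no docstring in the source.) -/
theorem toUC_tmul (X : U.Var) (k : ℕ) (c : ℂ) (x : U.padH6.Coh X k) : toUC X k (c ⊗ₜ x) = c ⊗ₜ toU X k x := rfl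

/-- (Ported verbatim from the HodgeCMPerL package; no docstring in the source.) -/
theorem padOfC_tmul (X : U.Var) (k : ℕ) (c : ℂ) (x : U.padH6.Coh X k) : padOfC X k (c ⊗ₜ x) = c ⊗ₜ padOf X k x :=
  rfl

/-- (Ported verbatim from the HodgeCMPerL package; no docstring in the source.) -/
theorem toUC_ofRat (X : U.Var) (k : ℕ) (x : U.padH6.Coh X k) : toUC X k (ofRat x) = ofRat (toU X k x) :=
  PadSix.baseChange_ofRat _ x

/-- (Ported verbatim from the HodgeCMPerL package; no docstring in the source.) -/
theorem padOfC_ofRat (X : U.Var) (k : ℕ) (x : U.padH6.Coh X k) : padOfC X k (ofRat x) = ofRat (padOf X k x) :=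
  PadSix.baseChange_ofRat _ x

/-- (Ported verbatim from the HodgeCMPerL package; no docstring in the source.) -/
theorem padOfC_of_ne (X : U.Var) {k : ℕ} (hk : k ≠ 6) (x : U.padH6.CohC X k) : padOfC X k x = 0 := by
  have h : padOf X k = 0 := LinearMap.ext (padOf_of_ne X hk)
  rw [padOfC, h, LinearMap.baseChange_zero, LinearMap.zero_apply]

/-- **The Hodge filtration of `U♯`, componentwise**: the geometric component lies in `F^p H^k(X)` and the pad component
in `F^p` of the pure `(3,3)` structure (i.e. is `0` if `p > 3`). -/
theorem mem_F_iff (X : U.Var) (k : ℕ) (p : ℤ) (x : U.padH6.CohC X k) :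
    x ∈ (U.padH6.hodge X k).F p ↔ toUC X k x ∈ (U.hodge X k).F p ∧ padOfC X k x ∈ pureFiltration (U.Coh X 6) 3 p :=
  PadSix.mem_hodge_F_iff k (U.hodge X k) (U.padHodge X) p x

/-- (Ported verbatim from the HodgeCMPerL package; no docstring in the source.) -/
theorem toUC_pullC {X Y : U.Var} (f : U.Mor X Y) (k : ℕ) (y : U.padH6.CohC Y k) :
    toUC X k (U.padH6.pullC f k y) = U.pullC f k (toUC Y k y) := by
  have h := congrArg (fun g : U.padH6.Coh Y k →ₗ[ℚ] U.Coh X k => g.baseChange ℂ y) (toU_comp_pull f k)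
  simp only [LinearMap.baseChange_comp, LinearMap.comp_apply] at h
  exact h

/-- (Ported verbatim from the HodgeCMPerL package; no docstring in the source.) -/
theorem padOfC_pullC {X Y : U.Var} (f : U.Mor X Y) (k : ℕ) (y : U.padH6.CohC Y k) :
    padOfC X k (U.padH6.pullC f k y) = U.pullC f 6 (padOfC Y k y) := by
  have h := congrArg (fun g : U.padH6.Coh Y k →ₗ[ℚ] U.Coh X 6 => g.baseChange ℂ y) (padOf_comp_pull f k)
  simp only [LinearMap.baseChange_comp, LinearMap.comp_apply] at h
  exact h

/-- (Ported verbatim from the HodgeCMPerL package; no docstring in the source.) -/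
theorem toUC_cupC (X : U.Var) (i j : ℕ) (x : U.padH6.CohC X i) (y : U.padH6.CohC X j) :
    toUC X (i + j) (U.padH6.cupC X i j x y) = U.cupC X i j (toUC X i x) (toUC X j y) := by
  induction x using TensorProduct.induction_on with
  | zero => simp only [map_zero, LinearMap.zero_apply]
  | tmul a x =>
    induction y using TensorProduct.induction_on with
    | zero => simp only [map_zero]
    | tmul b y => rw [cupC_tmul, toUC_tmul, toUC_tmul, toUC_tmul, cupC_tmul, toU_cup]
    | add y₁ y₂ h₁ h₂ => rw [map_add, map_add, h₁, h₂, map_add, map_add]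
  | add x₁ x₂ h₁ h₂ => rw [map_add, LinearMap.add_apply, map_add, h₁, h₂, map_add, map_add, LinearMap.add_apply]

/-- (Ported verbatim from the HodgeCMPerL package; no docstring in the source.) -/
theorem padOfC_cupC (X : U.Var) (i j : ℕ) (x : U.padH6.CohC X i) (y : U.padH6.CohC X j) :
    padOfC X (i + j) (U.padH6.cupC X i j x y) = 0 := by
  induction x using TensorProduct.induction_on with
  | zero => simp only [map_zero, LinearMap.zero_apply]
  | tmul a x =>
    induction y using TensorProduct.induction_on with
    | zero => simp only [map_zero]
    | tmul b y => rw [cupC_tmul, padOfC_tmul, padOf_cup, TensorProduct.tmul_zero]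
    | add y₁ y₂ h₁ h₂ => rw [map_add, map_add, h₁, h₂, add_zero]
  | add x₁ x₂ h₁ h₂ => rw [map_add, LinearMap.add_apply, map_add, h₁, h₂, add_zero]

/-- rational Hodge classes of `U♯`, componentwise -/
theorem ofRat_mem_F_iff (X : U.Var) (k : ℕ) (p : ℤ) (x : U.padH6.Coh X k) :
    (ofRat x : U.padH6.CohC X k) ∈ (U.padH6.hodge X k).F p ↔
      (ofRat (toU X k x) : U.CohC X k) ∈ (U.hodge X k).F p ∧
        (ofRat (padOf X k x) : U.CohC X 6) ∈ pureFiltration (U.Coh X 6) 3 p := by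
  rw [mem_F_iff, toUC_ofRat, padOfC_ofRat]

/-- (Ported verbatim from the HodgeCMPerL package; no docstring in the source.) -/
theorem ofU_bijective_of_ne (X : U.Var) {k : ℕ} (hk : k ≠ 6) : Function.Bijective (ofU X k) :=
  ⟨ofU_injective X k, fun x => ⟨toU X k x, ofU_toU_of_ne X hk x⟩⟩

/-! ## 3. Transport of the composite notions -/

/-- Commutation squares of pull-backs, in all degrees at once, are the same in `U♯` and in `U`. -/
theorem pull_comm_iff {W X Y Z : U.Var} (f : U.Mor W X) (g : U.Mor X Y) (f' : U.Mor Z Y) (g' : U.Mor W Z) :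
    (∀ k, U.padH6.pull f k ∘ₗ U.padH6.pull g k = U.padH6.pull g' k ∘ₗ U.padH6.pull f' k) ↔
      (∀ k, U.pull f k ∘ₗ U.pull g k = U.pull g' k ∘ₗ U.pull f' k) := by
  constructor
  · intro h k
    ext y
    have h' := LinearMap.congr_fun (h k) (ofU Y k y)
    rw [LinearMap.comp_apply, LinearMap.comp_apply] at h'
    have h'' := congrArg (toU W k) h'
    rw [toU_pull, toU_pull, toU_ofU, toU_pull, toU_pull, toU_ofU] at h''
    rw [LinearMap.comp_apply, LinearMap.comp_apply]
    exact h''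
  · intro h k
    refine LinearMap.ext fun y => (ext_iff W k _ _).mpr ⟨?_, ?_⟩
    · rw [LinearMap.comp_apply, LinearMap.comp_apply, toU_pull, toU_pull, toU_pull, toU_pull]
      exact LinearMap.congr_fun (h k) (toU Y k y)
    · rw [LinearMap.comp_apply, LinearMap.comp_apply, padOf_pull, padOf_pull, padOf_pull, padOf_pull]
      exact LinearMap.congr_fun (h 6) (padOf Y k y)

/-- Diagonal actions on the four-corner products are the same in `U♯` and in `U`. -/
theorem isDiagAct_iff {K : CMField} {Φ : Fin 4 → CMType K} {a : K} {M : U.Mor (U.prod4 K Φ) (U.prod4 K Φ)} :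
    U.padH6.IsDiagAct K Φ a M ↔ U.IsDiagAct K Φ a M := by
  constructor
  · rintro ⟨e, he1, he2⟩
    exact ⟨e, he1, fun i => (pull_comm_iff M (U.pr4 K Φ i) (e i) (U.pr4 K Φ i)).mp (he2 i)⟩
  · rintro ⟨e, he1, he2⟩
    exact ⟨e, he1, fun i => (pull_comm_iff M (U.pr4 K Φ i) (e i) (U.pr4 K Φ i)).mpr (he2 i)⟩

/-- (Ported verbatim from the HodgeCMPerL package; no docstring in the source.) -/
theorem dim_prod4 (M : U.ModelAxioms) (hd : U.Fact_dimProd) (K : CMField) (Φ : Fin 4 → CMType K) :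
    U.dim (U.prod4 K Φ) = 4 * K.halfDegree := by
  have hd' : ∀ X Y : U.Var, U.dim (U.prod X Y) = U.dim X + U.dim Y := hd
  have hc : ∀ Ψ : CMType K, U.dim (U.cmAV K Ψ) = K.halfDegree := fun Ψ => (M.cmAV K Ψ).2.2
  show U.dim (U.prod (U.prod (U.prod _ _) _) _) = _
  rw [hd', hd', hd', hc, hc, hc, hc]
  ring

/-- (Ported verbatim from the HodgeCMPerL package; no docstring in the source.) -/
theorem map_mem_pureFiltration {V W : Type} [AddCommGroup V] [Module ℚ V] [AddCommGroup W] [Module ℚ W]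
    (g : ℂ ⊗[ℚ] V →ₗ[ℂ] ℂ ⊗[ℚ] W) (k p : ℤ) {x : ℂ ⊗[ℚ] V} (hx : x ∈ pureFiltration V k p) :
    g x ∈ pureFiltration W k p := by
  by_cases h : p ≤ k
  · rw [HodgeStructure.pureFiltration_of_le h]; exact Submodule.mem_top
  · rw [HodgeStructure.pureFiltration_of_lt (not_le.mp h)] at hx ⊢
    rw [(Submodule.mem_bot ℂ).mp hx, map_zero]
    exact Submodule.zero_mem _

/-! ## 4. `U♯` is a model whenever `U` is -/

set_option smartUnfolding false in
/-- **`U♯` satisfies all 28 model facts whenever `U` does** — given `dim (X × Y) = dim X + dim Y` in `U` (`Fact_dimProd`,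
used for M28 only: with M11 it gives `dim P = 4g`, so the source degree `2(dim P - 2) = 8g - 4` of the algebraic
self-duality is never the padded degree `6`).  Eighteen of the facts live in the literal degrees `0, 1, 2, 4` (or do not
mention cohomology) and hold in `U♯` by the proof term for `U`. -/
theorem modelAxioms (M : U.ModelAxioms) (hd : U.Fact_dimProd) : U.padH6.ModelAxioms where
  pull_id X k := by
    show PadSix.map k (U.pull (U.idMor X) k) (U.pull (U.idMor X) 6) = LinearMap.id
    rw [M.pull_id X k, M.pull_id X 6]
    exact PadSix.map_id k
  pull_comp X Y Z f g k := by
    show PadSix.map k (U.pull (U.comp f g) k) (U.pull (U.comp f g) 6) =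
      PadSix.map k (U.pull f k) (U.pull f 6) ∘ₗ PadSix.map k (U.pull g k) (U.pull g 6)
    rw [M.pull_comp X Y Z f g k, M.pull_comp X Y Z f g 6]
    exact PadSix.map_comp k _ _ _ _
  pull_cup X Y f i j x y := by
    refine (ext_iff (U := U) X (i + j) _ _).mpr ⟨?_, ?_⟩
    · rw [toU_pull, toU_cup, toU_cup, toU_pull, toU_pull]
      exact M.pull_cup X Y f i j _ _
    · rw [padOf_pull, padOf_cup, padOf_cup, map_zero]
  pull_hodge X Y f k p := by
    rintro _ ⟨y, hy, rfl⟩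
    rw [SetLike.mem_coe, mem_F_iff] at hy
    rw [mem_F_iff, toUC_pullC, padOfC_pullC]
    exact ⟨M.pull_hodge X Y f k p ⟨_, hy.1, rfl⟩, map_mem_pureFiltration _ 3 p hy.2⟩
  cup2_hodge X k p q x y hx hy := by
    rw [cup2C_eq_cupC, mem_F_iff, toUC_cupC, padOfC_cupC, ← cup2C_eq_cupC]
    exact ⟨M.cup2_hodge X k p q _ _ ((mem_F_iff (U := U) X k p x).mp hx).1 ((mem_F_iff (U := U) X k q y).mp hy).1,
      Submodule.zero_mem _⟩
  tr_degree X k hk := by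
    show U.tr X k ∘ₗ PadSix.fst (U.Coh X k) (U.Coh X 6) k = 0
    rw [M.tr_degree X k hk, LinearMap.zero_comp]
  alg_le_hodge X p := by
    intro x hx
    rw [mem_alg_iff] at hx
    show x ∈ (U.padH6.hodge X (2 * p)).hodgeClasses (p : ℤ)
    rw [HodgeStructure.mem_hodgeClasses_iff, ofRat_mem_F_iff, hx.2, map_zero]
    exact ⟨M.alg_le_hodge X p hx.1, Submodule.zero_mem _⟩
  pull_alg X Y f p := by
    rintro _ ⟨y, hy, rfl⟩
    rw [SetLike.mem_coe, mem_alg_iff] at hy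
    rw [mem_alg_iff, toU_pull, padOf_pull, hy.2, map_zero]
    exact ⟨M.pull_alg X Y f p ⟨_, hy.1, rfl⟩, rfl⟩
  cup_alg X x y hx hy := M.cup_alg X x y hx hy
  lefschetz11 X := M.lefschetz11 X
  cmAV := M.cmAV
  eigenLine := M.eigenLine
  alphaLine := M.alphaLine
  cmDominated X hX := by
    obtain ⟨F, hG, h6, n, Θ, s, π, N, hN, h⟩ := M.cmDominated X hX
    refine ⟨F, hG, h6, n, Θ, s, π, N, hN, fun k => LinearMap.ext fun x => (ext_iff (U := U) X k _ _).mpr ⟨?_, ?_⟩⟩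
    · rw [toU_pull]
      refine (LinearMap.congr_fun (h k) (toU (U := U) X k x)).trans ?_
      rw [LinearMap.smul_apply, LinearMap.id_apply, LinearMap.smul_apply, LinearMap.id_apply, map_smul]
    · by_cases hk : k = 6
      · subst hk
        rw [padOf_pull]
        refine (LinearMap.congr_fun (h 6) (padOf (U := U) X 6 x)).trans ?_
        rw [LinearMap.smul_apply, LinearMap.id_apply, LinearMap.smul_apply, LinearMap.id_apply, map_smul]
      · rw [padOf_of_ne (U := U) X hk, padOf_of_ne (U := U) X hk]
  weilLine_rank := M.weilLine_rank
  weilLine_hodge := M.weilLine_hodge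
  pms_dim := M.pms_dim
  lift := M.lift
  cup_comm1 := M.cup_comm1
  cup_interchange := M.cup_interchange
  kunneth1 := M.kunneth1
  H1_rank := M.H1_rank
  H4_span := M.H4_span
  cmEnd := M.cmEnd
  conjIsogeny := M.conjIsogeny
  gysin_surface S X f hS := by
    obtain ⟨c, hc, h⟩ := M.gysin_surface S X f hS
    refine ⟨ofU (U := U) X (2 * (U.dim X - 2)) c, ofU_mem_alg (U := U) X _ hc, fun y => ?_⟩
    rw [tr_apply, toU_pull, tr_apply, toU_cup, toU_ofU]
    exact h (toU (U := U) X 4 y)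
  deg_diag K Φ a Ma hMa k := by
    have h := M.deg_diag K Φ a Ma (isDiagAct_iff.mp hMa) k
    ext x
    rw [LinearMap.comp_apply, LinearMap.smul_apply, tr_apply, toU_pull, tr_apply]
    exact LinearMap.congr_fun h (toU (U := U) (U.prod4 K Φ) k x)
  algDuality K Φ := by
    obtain ⟨D, hD1, hD2, hD3⟩ := M.algDuality K Φ
    have hP := dim_prod4 M hd K Φ
    have hdim : 2 * (U.dim (U.prod4 K Φ) - 2) ≠ 6 := by omega
    refine ⟨ofU _ 4 ∘ₗ D ∘ₗ toU _ (2 * (U.dim (U.prod4 K Φ) - 2)), ?_, ?_, ?_⟩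
    · exact (ofU_bijective_of_ne _ (by norm_num)).comp (hD1.comp (toU_bijective_of_ne _ hdim))
    · rintro _ ⟨x, hx, rfl⟩
      rw [SetLike.mem_coe, mem_alg_iff] at hx
      exact ofU_mem_alg _ 2 (hD2 ⟨_, hx.1, rfl⟩)
    · intro a Ma Mb hMa hMb
      have h := hD3 a Ma Mb (isDiagAct_iff.mp hMa) (isDiagAct_iff.mp hMb)
      ext x
      have hx := LinearMap.congr_fun h (toU (U.prod4 K Φ) (2 * (U.dim (U.prod4 K Φ) - 2)) x)
      simp only [LinearMap.comp_apply, LinearMap.smul_apply] at hx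
      rw [LinearMap.comp_apply, LinearMap.comp_apply, LinearMap.comp_apply, LinearMap.comp_apply,
        LinearMap.smul_apply, LinearMap.comp_apply, LinearMap.comp_apply, toU_pull, pull_ofU, hx, map_smul]

/-! ## 5. N2, N3, N4, F4, F5, `Fact_dimProd`, `W_RK4` transfer; factor actions and weight vectors componentwise -/


-- port_pkg: scope closed for this part
end PadH6
end Universe
end HodgeCM
end
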